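import Summits.PneNP.PneNP.Theorems.Capture.Negative.LoadBearing
import Literature.Computability.Complexity.NegationLimited
import HarnessLib.Audit

/-!
# Strategy census (strategist s2) for the crux `Capture` (stmt-PneNP-2659) — typed companions

Companion file of `Cruxes/Capture/STRATEGY-CENSUS.md` (planner-cstrat-stmt-PneNP-2659-s2-0, 2026-08-17).
It records, as Lean objects over tree declarations, the typed forms used in the census:

* `OneNegSuffices`, `OneNegElim` and the PROVED glue `capture_of_negLadder` — the best typed split found
  under the heading DECOMPOSITION (the negation ladder between Fischer's `⌈log₂(n+1)⌉` NOT gates and `0`);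
  the census explains why neither piece is easier than the crux (Markov's bound is basis-independent;
  Jukna 2012 Claim 10.22).
* `TwoSliceCapture` and `twoSlice_of_capture` — the ATOM of the crux identified under STRENGTHEN /
  TRANSFER: capture for functions living on two adjacent slices (one seam), the first case beyond
  Berkowitz's theorem (`captureSlice`, landed `Negative/SliceCapture.lean`) — strictly a special case, open.
* `SeamLinear` — the strengthened (inductive) form of one seam; stated only (no endorsement): the census
  explains why no mechanism for it is known and why the black-box version is refuted
  (`CruxTriage.no_uniform_monotone_band_merge`, TRIAGE-r1-1 App. B).

Nothing here is a proof of, or evidence against, `Capture`.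
-/

set_option linter.dupNamespace false

namespace Summit.PneNP.PneNP.Cruxes.Capture.StrategistS2

open Literature.Computability.Complexity
open Summit.PneNP.PneNP.Theses.ConvexRankGates (Capture)
open Summit.PneNP.PneNP.Theorems.Capture.Negative (CaptureInto capture_iff)

/-- Hamming weight of a Boolean point of a finite cube. -/
def weight {ι : Type} [Fintype ι] (x : ι → Bool) : ℕ :=
  (Finset.univ.filter fun i => x i = true).card

/-- **Ladder piece 1 (ONE NEGATION SUFFICES with wide gates).** Every monotone `f` with a `B₂`-circuit of
size `t` on `n` inputs has a circuit with at most `N = (t+n+2)^a` gates over `extGate N ∪ {¬}` using AT MOST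
ONE NOT gate. (Fischer: `⌈log₂(n+1)⌉` NOT gates suffice even without wide gates; `Capture` is the case of
zero NOT gates; this is the rung in between.) -/
def OneNegSuffices : Prop :=
  ∃ a : ℕ, ∀ (ι : Type) (_ : Fintype ι) (f : (ι → Bool) → Bool), Monotone f →
    ∀ C : Circuit ι, C.IsOver B2 → C.Computes f →
      ∃ C₁ : Circuit ι, C₁.IsOver (extGate ((C.size + Fintype.card ι + 2) ^ a) ∪ {GateFn.not}) ∧
        C₁.negationCount ≤ 1 ∧ C₁.size ≤ (C.size + Fintype.card ι + 2) ^ a ∧ C₁.Computes f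

/-- **Ladder piece 2 (ONE NEGATION CAN BE ELIMINATED).** If a monotone `f` has a `B₂`-circuit of size `t`
AND a circuit of size `t₁` over `extGate s ∪ {¬}` with at most one NOT gate, then it has a circuit over
`extGate M` with at most `M = (t + t₁ + s + n + 2)^b` gates. -/
def OneNegElim : Prop :=
  ∃ b : ℕ, ∀ (ι : Type) (_ : Fintype ι) (f : (ι → Bool) → Bool), Monotone f →
    ∀ C : Circuit ι, C.IsOver B2 → C.Computes f →
      ∀ (s : ℕ) (C₁ : Circuit ι), C₁.IsOver (extGate s ∪ {GateFn.not}) → C₁.negationCount ≤ 1 →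
        C₁.Computes f →
          ∃ C' : Circuit ι, C'.IsOver (extGate ((C.size + C₁.size + s + Fintype.card ι + 2) ^ b)) ∧
            C'.size ≤ (C.size + C₁.size + s + Fintype.card ι + 2) ^ b ∧ C'.Computes f

/-- Size bookkeeping for the ladder glue: `t + N + N + n + 2 ≤ (t+n+2)^(a+2)` when `N ≤ (t+n+2)^a`. -/
theorem ladder_bookkeeping (t n a N : ℕ) (hN : N ≤ (t + n + 2) ^ a) :
    t + N + N + n + 2 ≤ (t + n + 2) ^ (a + 2) := by
  have h2 : 2 ≤ t + n + 2 := by omega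
  have h1 : 1 ≤ t + n + 2 := by omega
  have hpow : t + n + 2 ≤ (t + n + 2) ^ (a + 1) := by
    calc t + n + 2 = (t + n + 2) ^ 1 := (pow_one _).symm
      _ ≤ (t + n + 2) ^ (a + 1) := Nat.pow_le_pow_right h1 (by omega)
  have hNa : N ≤ (t + n + 2) ^ (a + 1) :=
    hN.trans (Nat.pow_le_pow_right h1 (by omega))
  have hstep : 2 * (t + n + 2) ^ (a + 1) ≤ (t + n + 2) ^ (a + 2) := by
    calc 2 * (t + n + 2) ^ (a + 1) ≤ (t + n + 2) * (t + n + 2) ^ (a + 1) :=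
          Nat.mul_le_mul_right _ h2
      _ = (t + n + 2) ^ (a + 2) := by ring
  have hNN : N + N ≤ (t + n + 2) ^ (a + 1) := by
    have : 2 * N ≤ 2 * (t + n + 2) ^ a := Nat.mul_le_mul_left 2 hN
    calc N + N = 2 * N := by ring
      _ ≤ 2 * (t + n + 2) ^ a := this
      _ ≤ (t + n + 2) * (t + n + 2) ^ a := Nat.mul_le_mul_right _ h2
      _ = (t + n + 2) ^ (a + 1) := by ring
  calc t + N + N + n + 2 = (t + n + 2) + (N + N) := by ring
    _ ≤ (t + n + 2) ^ (a + 1) + (t + n + 2) ^ (a + 1) := Nat.add_le_add hpow hNN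
    _ = 2 * (t + n + 2) ^ (a + 1) := by ring
    _ ≤ (t + n + 2) ^ (a + 2) := hstep

/-- **The negation ladder is a typed split of the crux with a proved glue**:
`OneNegSuffices ∧ OneNegElim → Capture` (and conversely each piece follows from `Capture`, so the split is
exact). The census (heading DECOMPOSITION) explains why it has no teeth: both pieces inherit the whole
weight-selection difficulty. -/
theorem capture_of_negLadder (h₁ : OneNegSuffices) (h₂ : OneNegElim) : Capture := by
  rw [capture_iff]
  obtain ⟨a, h₁⟩ := h₁
  obtain ⟨b, h₂⟩ := h₂
  refine ⟨(a + 2) * b, fun ι _ f hf C hB hC => ?_⟩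
  obtain ⟨C₁, hC₁over, hC₁neg, hC₁size, hC₁comp⟩ := h₁ ι _ f hf C hB hC
  obtain ⟨C', hC'over, hC'size, hC'comp⟩ :=
    h₂ ι _ f hf C hB hC ((C.size + Fintype.card ι + 2) ^ a) C₁ hC₁over hC₁neg hC₁comp
  have hK : C.size + C₁.size + (C.size + Fintype.card ι + 2) ^ a + Fintype.card ι + 2 ≤
      (C.size + Fintype.card ι + 2) ^ (a + 2) := by
    have := ladder_bookkeeping C.size (Fintype.card ι) a ((C.size + Fintype.card ι + 2) ^ a) le_rfl
    have hC₁' : C.size + C₁.size + (C.size + Fintype.card ι + 2) ^ a + Fintype.card ι + 2 ≤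
        C.size + (C.size + Fintype.card ι + 2) ^ a + (C.size + Fintype.card ι + 2) ^ a +
          Fintype.card ι + 2 := by omega
    exact hC₁'.trans this
  have hKb : (C.size + C₁.size + (C.size + Fintype.card ι + 2) ^ a + Fintype.card ι + 2) ^ b ≤
      (C.size + Fintype.card ι + 2) ^ ((a + 2) * b) := by
    rw [pow_mul]
    exact Nat.pow_le_pow_left hK b
  exact ⟨C', hC'over.extGate_of_le hKb, hC'size.trans hKb, hC'comp⟩

/-- **The atom of the crux: TWO-SLICE CAPTURE.** `Capture` restricted to functions living on two adjacent
slices `k, k+1` of the cube (`0` below weight `k`, `1` above weight `k+1`). For ONE slice this is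
Berkowitz's theorem with target `{∧₂,∨₂,0,1}` and no wide gate (`captureSlice`); for two adjacent slices
no pseudo-complement exists (`¬xᵢ` restricted to slices `k,k+1` is not monotone), and the statement is the
one-seam selection problem in pure form — open, strictly a special case of the crux, refutation still
Valiant-hard (`notCaptureImpValiant` applies to every monotone P/poly family). -/
def TwoSliceCapture : Prop :=
  ∃ a : ℕ, ∀ (ι : Type) (_ : Fintype ι) (f : (ι → Bool) → Bool), Monotone f →
    (∃ k : ℕ, (∀ x, weight x < k → f x = false) ∧ (∀ x, k + 1 < weight x → f x = true)) →
      ∀ C : Circuit ι, C.IsOver B2 → C.Computes f →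
        ∃ C' : Circuit ι, C'.IsOver (extGate ((C.size + Fintype.card ι + 2) ^ a)) ∧
          C'.size ≤ (C.size + Fintype.card ι + 2) ^ a ∧ C'.Computes f

/-- `TwoSliceCapture` is a special case of the crux. -/
theorem twoSlice_of_capture (h : Capture) : TwoSliceCapture := by
  rw [capture_iff] at h
  obtain ⟨a, h⟩ := h
  exact ⟨a, fun ι _ f hf _ C hB hC => h ι _ f hf C hB hC⟩

/-- **The strengthened, inductive form of one seam (STRENGTHEN heading; stated, NOT endorsed).**
`Sel_k(A,V) := V ∨ (A ∧ [|x| < k])` for two extended-monotone circuits `A, V` whose selection happens to be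
monotone, realised over the extended basis with overhead LINEAR in `|A| + |V|` (plus a polynomial in the
width and `n`). Linear overhead + dyadic merging of Berkowitz slice circuits would give `Capture` in
`⌈log₂(n+1)⌉` rounds; the black-box version (a gadget reading only the two output wires) is refuted for every
`n ≥ 1` (`no_uniform_monotone_band_merge`, TRIAGE-r1-1 App. B), and no white-box mechanism is known. -/
def SeamLinear : Prop :=
  ∃ c d : ℕ, ∀ (ι : Type) (_ : Fintype ι) (k s : ℕ) (A V : Circuit ι),
    A.IsOver (extGate s) → V.IsOver (extGate s) →
      Monotone (fun x => V.eval x || (A.eval x && decide (weight x < k))) →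
        ∃ S : Circuit ι, S.IsOver (extGate ((s + Fintype.card ι + 2) ^ d)) ∧
          S.size ≤ c * (A.size + V.size) + (s + Fintype.card ι + 2) ^ d ∧
          S.Computes fun x => V.eval x || (A.eval x && decide (weight x < k))

end Summit.PneNP.PneNP.Cruxes.Capture.StrategistS2
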